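import Mathlib
import Literature.Analysis.FluidPDE.GaussianVortexPlanar
import Literature.Analysis.FluidPDE.BiotSavart2DSymmetry
import HarnessLib

/-!
# Circle means along rotation orbits (stub `stub_cellSolvability`, reduction step 2)

Helper file for the stub `stub_cellSolvability` of the line `braid-closed-large-circulation-gluing`
(crux stmt-AnomalousDissipation-3009, `MarginalStabilityChain.StretchedVortexRows`). The stub's
data `g` have VANISHING CIRCLE MEANS, `∫₀^{2π} g(r cos θ, r sin θ) dθ = 0` for `r > 0`; the
reduction `stub_cellSolvability_of_streamSolvability` needs this hypothesis in two other guises,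
proved here and packaged in the registered sub-goal `stub_cellSolvability_circleMeans`:

* `∫₀^{2π} g(R_σ ξ) dσ = 0` at EVERY point `ξ`, `R_σ ξ = cos σ·ξ + sin σ·ξ^⊥` (for `ξ ≠ 0` the
  orbit is the circle of radius `|ξ|` traversed from the polar angle `arg(ξ₀ + iξ₁)`, and a full
  turn of a `2π`-periodic integrand does not depend on the starting angle; for `ξ = 0` one needs
  `g(0) = 0`, which follows from the hypothesis by continuity of `r ↦ ∫₀^{2π} g(r cos θ, r sin θ) dθ`
  at `r = 0`, where it equals `2π g(0)`) — this kills the bulk term of `∂_θ ∂_θ⁻¹ g = g − mean`;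
* the circle means of the angular primitive `(A g)(ξ) = ∫₀^{2π} ((σ−π)/(2π)) g(R_σ ξ) dσ` vanish
  for every radius (Fubini on `[0, 2π]²`, then a shifted full turn), so that the cell datum
  `F = Ω⁻¹ A g` again has vanishing circle means.
-/

set_option linter.dupNamespace false

noncomputable section

open scoped BigOperators Topology RealInnerProductSpace ContDiff Interval
open Filter Set Function MeasureTheory WithLp intervalIntegral

namespace Summit.AnomalousDissipation.AnomalousDissipation.Theorems.MarginalStabilityChainStretchedVortexRows

open Literature.Analysis.FluidPDE

/-! ### Circle means -/

/-- The circle point `(r cos θ, r sin θ)` rotated by `σ` is the circle point at angle `θ + σ`.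
[folklore] -/
theorem rot_toLp_cos_sin (r θ σ : ℝ) :
    Real.cos σ • (toLp 2 ![r * Real.cos θ, r * Real.sin θ] : EuclideanSpace ℝ (Fin 2)) +
        Real.sin σ • perp (toLp 2 ![r * Real.cos θ, r * Real.sin θ]) =
      toLp 2 ![r * Real.cos (θ + σ), r * Real.sin (θ + σ)] := by
  ext i
  fin_cases i
  · simp [perp, Real.cos_add]; ring
  · simp [perp, Real.sin_add]; ring

/-- Polar angle: every `ξ` is the circle point of radius `|ξ|` at the angle `arg(ξ₀ + iξ₁)`.
[folklore] -/
theorem eq_toLp_cos_sin_arg (ξ : EuclideanSpace ℝ (Fin 2)) :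
    ξ = toLp 2 ![‖ξ‖ * Real.cos (Complex.arg ⟨ξ 0, ξ 1⟩), ‖ξ‖ * Real.sin (Complex.arg ⟨ξ 0, ξ 1⟩)] := by
  have hn : ‖(⟨ξ 0, ξ 1⟩ : ℂ)‖ = ‖ξ‖ := by
    rw [Complex.norm_eq_sqrt_sq_add_sq, EuclideanSpace.norm_eq]
    simp [Fin.sum_univ_two]
  have h0 := Complex.norm_mul_cos_arg (⟨ξ 0, ξ 1⟩ : ℂ)
  have h1 := Complex.norm_mul_sin_arg (⟨ξ 0, ξ 1⟩ : ℂ)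
  rw [hn] at h0 h1
  ext i
  fin_cases i
  · simpa using h0.symm
  · simpa using h1.symm

/-- `θ ↦ g(r cos θ, r sin θ)` is `2π`-periodic. [folklore] -/
theorem periodic_comp_toLp_cos_sin (g : EuclideanSpace ℝ (Fin 2) → ℝ) (r : ℝ) :
    Function.Periodic (fun θ : ℝ => g (toLp 2 ![r * Real.cos θ, r * Real.sin θ])) (2 * Real.pi) :=
  fun θ => by simp [Real.cos_add_two_pi, Real.sin_add_two_pi]

/-- A shifted full turn has the same integral: `∫₀^{2π} g(pt_r(θ + σ)) dθ = ∫₀^{2π} g(pt_r θ) dθ`.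
[folklore] -/
theorem intervalIntegral_comp_toLp_cos_sin_add (g : EuclideanSpace ℝ (Fin 2) → ℝ) (r σ : ℝ) :
    (∫ θ in (0 : ℝ)..(2 * Real.pi), g (toLp 2 ![r * Real.cos (θ + σ), r * Real.sin (θ + σ)])) =
      ∫ θ in (0 : ℝ)..(2 * Real.pi), g (toLp 2 ![r * Real.cos θ, r * Real.sin θ]) := by
  have h := intervalIntegral.integral_comp_add_right (a := (0 : ℝ)) (b := 2 * Real.pi)
    (fun θ : ℝ => g (toLp 2 ![r * Real.cos θ, r * Real.sin θ])) σ
  simp only at h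
  rw [h, zero_add, show 2 * Real.pi + σ = σ + 2 * Real.pi by ring,
    (periodic_comp_toLp_cos_sin g r).intervalIntegral_add_eq σ 0, zero_add]

/-- A continuous function with vanishing circle means vanishes at the origin (the circle mean is
continuous in the radius and equals `2π g(0)` at `r = 0`). [folklore] -/
theorem eq_zero_of_circleMean_eq_zero {g : EuclideanSpace ℝ (Fin 2) → ℝ} (hg : Continuous g)
    (h0 : ∀ r, 0 < r → ∫ θ in (0 : ℝ)..(2 * Real.pi), g (toLp 2 ![r * Real.cos θ, r * Real.sin θ]) = 0) :
    g 0 = 0 := by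
  set f : ℝ → ℝ := fun r => ∫ θ in (0 : ℝ)..(2 * Real.pi), g (toLp 2 ![r * Real.cos θ, r * Real.sin θ])
    with hf
  have hpt : Continuous fun p : ℝ × ℝ =>
      (toLp 2 ![p.1 * Real.cos p.2, p.1 * Real.sin p.2] : EuclideanSpace ℝ (Fin 2)) := by
    refine (PiLp.continuous_toLp 2 _).comp (continuous_pi fun i => ?_)
    fin_cases i
    · exact continuous_fst.mul (Real.continuous_cos.comp continuous_snd)
    · exact continuous_fst.mul (Real.continuous_sin.comp continuous_snd)
  have hfc : Continuous f :=
    intervalIntegral.continuous_parametric_intervalIntegral_of_continuous'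
      (f := fun r θ => g (toLp 2 ![r * Real.cos θ, r * Real.sin θ])) (hg.comp hpt) _ _
  have hlim : Tendsto f (𝓝[>] 0) (𝓝 (f 0)) := (hfc.tendsto 0).mono_left nhdsWithin_le_nhds
  have hlim0 : Tendsto f (𝓝[>] 0) (𝓝 0) := by
    refine tendsto_const_nhds.congr' ?_
    filter_upwards [self_mem_nhdsWithin] with r hr
    exact (h0 r hr).symm
  have hf0 : f 0 = 0 := tendsto_nhds_unique hlim hlim0
  have hval : f 0 = (2 * Real.pi) * g 0 := by
    simp only [hf, zero_mul]
    have : (toLp 2 ![(0 : ℝ), 0] : EuclideanSpace ℝ (Fin 2)) = 0 := by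
      ext i; fin_cases i <;> simp
    rw [this, intervalIntegral.integral_const, smul_eq_mul, sub_zero]
  have hπ : (2 * Real.pi) ≠ 0 := by positivity
  rw [hf0] at hval
  exact (mul_eq_zero.1 hval.symm).resolve_left hπ

/-- **Vanishing circle means are seen along every rotation orbit**: if the circle means of a
continuous `g` vanish for all radii `r > 0`, then `∫₀^{2π} g(R_σ ξ) dσ = 0` at every point `ξ`
(including `ξ = 0`, where `g(0) = 0`). [folklore] -/
theorem intervalIntegral_comp_rot_eq_zero {g : EuclideanSpace ℝ (Fin 2) → ℝ} (hg : Continuous g)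
    (h0 : ∀ r, 0 < r → ∫ θ in (0 : ℝ)..(2 * Real.pi), g (toLp 2 ![r * Real.cos θ, r * Real.sin θ]) = 0)
    (ξ : EuclideanSpace ℝ (Fin 2)) :
    ∫ σ in (0 : ℝ)..(2 * Real.pi), g (Real.cos σ • ξ + Real.sin σ • perp ξ) = 0 := by
  by_cases hξ : ξ = 0
  · subst hξ
    simp only [perp_zero, smul_zero, add_zero, eq_zero_of_circleMean_eq_zero hg h0,
      intervalIntegral.integral_const, smul_eq_mul, mul_zero]
  · have hr : 0 < ‖ξ‖ := norm_pos_iff.2 hξ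
    set θ₀ : ℝ := Complex.arg ⟨ξ 0, ξ 1⟩ with hθ₀
    have hrepr := eq_toLp_cos_sin_arg ξ
    rw [← hθ₀] at hrepr
    have hrot : ∀ σ : ℝ, Real.cos σ • ξ + Real.sin σ • perp ξ =
        toLp 2 ![‖ξ‖ * Real.cos (θ₀ + σ), ‖ξ‖ * Real.sin (θ₀ + σ)] := fun σ => by
      conv_lhs => rw [hrepr]
      exact rot_toLp_cos_sin ‖ξ‖ θ₀ σ
    simp_rw [hrot]
    have h := intervalIntegral.integral_comp_add_left (a := (0 : ℝ)) (b := 2 * Real.pi)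
      (fun θ : ℝ => g (toLp 2 ![‖ξ‖ * Real.cos θ, ‖ξ‖ * Real.sin θ])) θ₀
    simp only at h
    rw [h, add_zero, (periodic_comp_toLp_cos_sin g ‖ξ‖).intervalIntegral_add_eq θ₀ 0, zero_add]
    exact h0 ‖ξ‖ hr

/-- **The circle means of the angular primitive vanish** (Fubini on `[0, 2π]²` and a shifted full
turn of the circle). [folklore] -/
theorem circleMean_angularPrimitive_eq_zero {g : EuclideanSpace ℝ (Fin 2) → ℝ} (hg : Continuous g)
    (h0 : ∀ r, 0 < r → ∫ θ in (0 : ℝ)..(2 * Real.pi), g (toLp 2 ![r * Real.cos θ, r * Real.sin θ]) = 0)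
    (r : ℝ) :
    ∫ θ in (0 : ℝ)..(2 * Real.pi), (∫ σ in (0 : ℝ)..(2 * Real.pi), (σ - Real.pi) / (2 * Real.pi) *
      g (Real.cos σ • (toLp 2 ![r * Real.cos θ, r * Real.sin θ] : EuclideanSpace ℝ (Fin 2)) +
        Real.sin σ • perp (toLp 2 ![r * Real.cos θ, r * Real.sin θ]))) = 0 := by
  simp_rw [rot_toLp_cos_sin]
  -- swap the integrals
  have hcont : Continuous fun q : ℝ × ℝ => (q.2 - Real.pi) / (2 * Real.pi) *
      g (toLp 2 ![r * Real.cos (q.1 + q.2), r * Real.sin (q.1 + q.2)]) := by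
    refine ((continuous_snd.sub continuous_const).div_const _).mul (hg.comp ?_)
    refine (PiLp.continuous_toLp 2 _).comp (continuous_pi fun i => ?_)
    fin_cases i
    · exact continuous_const.mul (Real.continuous_cos.comp (continuous_fst.add continuous_snd))
    · exact continuous_const.mul (Real.continuous_sin.comp (continuous_fst.add continuous_snd))
  have hint : IntegrableOn (Function.uncurry fun θ σ : ℝ => (σ - Real.pi) / (2 * Real.pi) *
      g (toLp 2 ![r * Real.cos (θ + σ), r * Real.sin (θ + σ)]))
      (Ι (0 : ℝ) (2 * Real.pi) ×ˢ Ι (0 : ℝ) (2 * Real.pi)) := by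
    refine (hcont.continuousOn.integrableOn_compact (isCompact_uIcc.prod isCompact_uIcc)).mono_set
      (Set.prod_mono uIoc_subset_uIcc uIoc_subset_uIcc)
  rw [MeasureTheory.intervalIntegral_intervalIntegral_swap hint]
  simp_rw [intervalIntegral.integral_const_mul, intervalIntegral_comp_toLp_cos_sin_add g r]
  by_cases hr : 0 < r
  · simp [h0 r hr]
  · -- `r ≤ 0`: reduce to the radius `-r ≥ 0` by the half-turn `θ ↦ θ + π`, or `r = 0` directly
    rcases (not_lt.1 hr).eq_or_lt with h | h
    · subst h
      have hz : ∀ θ : ℝ, (toLp 2 ![(0 : ℝ) * Real.cos θ, 0 * Real.sin θ] : EuclideanSpace ℝ (Fin 2)) = 0 :=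
        fun θ => by ext i; fin_cases i <;> simp
      simp_rw [hz, eq_zero_of_circleMean_eq_zero hg h0]
      simp
    · have hneg : 0 < -r := by linarith
      have hflip : (∫ θ in (0 : ℝ)..(2 * Real.pi),
          g (toLp 2 ![r * Real.cos θ, r * Real.sin θ])) =
          ∫ θ in (0 : ℝ)..(2 * Real.pi), g (toLp 2 ![(-r) * Real.cos (θ + Real.pi),
            (-r) * Real.sin (θ + Real.pi)]) := by
        refine intervalIntegral.integral_congr fun θ _ => ?_
        simp [Real.cos_add_pi, Real.sin_add_pi]
      rw [hflip, intervalIntegral_comp_toLp_cos_sin_add g (-r) Real.pi, h0 (-r) hneg]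
      simp

/-! ### The registered package -/

/-- **Circle means along rotation orbits** (registered on stmt-AnomalousDissipation-3009 as the
sub-goal `stub_cellSolvability_circleMeans`; step 2 of the reduction
`stub_cellSolvability_of_streamSolvability`). If `g` is continuous with vanishing circle means for
all radii `r > 0`, then `∫₀^{2π} g(cos σ·ξ + sin σ·ξ^⊥) dσ = 0` at every `ξ`, and the circle means of
the angular primitive `∫₀^{2π} ((σ−π)/(2π)) g(cos σ·ξ + sin σ·ξ^⊥) dσ` vanish for every radius.
[folklore] -/
theorem stub_cellSolvability_circleMeans : ∀ g : EuclideanSpace ℝ (Fin 2) → ℝ, Continuous g →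
    (∀ r, 0 < r → ∫ θ in (0 : ℝ)..(2 * Real.pi), g (toLp 2 ![r * Real.cos θ, r * Real.sin θ]) = 0) →
    (∀ ξ : EuclideanSpace ℝ (Fin 2),
      ∫ σ in (0 : ℝ)..(2 * Real.pi), g (Real.cos σ • ξ + Real.sin σ • perp ξ) = 0) ∧
    ∀ r : ℝ, ∫ θ in (0 : ℝ)..(2 * Real.pi), (∫ σ in (0 : ℝ)..(2 * Real.pi),
      (σ - Real.pi) / (2 * Real.pi) *
        g (Real.cos σ • (toLp 2 ![r * Real.cos θ, r * Real.sin θ] : EuclideanSpace ℝ (Fin 2)) +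
          Real.sin σ • perp (toLp 2 ![r * Real.cos θ, r * Real.sin θ]))) = 0 := by
  intro g hg h0
  exact ⟨intervalIntegral_comp_rot_eq_zero hg h0, circleMean_angularPrimitive_eq_zero hg h0⟩

end Summit.AnomalousDissipation.AnomalousDissipation.Theorems.MarginalStabilityChainStretchedVortexRows

end
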